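import Summits.NavierStokesRegularity.NavierStokesRegularity.Theorems.AdaptedFrequencyAdaptedFrequencyConvergesStubEnstrophyC2
import Summits.NavierStokesRegularity.NavierStokesRegularity.Theorems.AdaptedFrequencyAdaptedFrequencyConvergesStubPinchingUpper
import Summits.NavierStokesRegularity.NavierStokesRegularity.Theorems.AdaptedFrequencyAdaptedFrequencyConvergesStubPinchingLower

/-!
# Band exclusion hides a monotonicity formula (crux stmt-NavierStokesRegularity-10493, line `unsteadiness-squeeze`)

Negative-side structural lemma about the line's hardest stub `stub_bandExclusion`
("`(T − τ)·Λ′(τ) ≥ 0` on a final window", i.e. the adapted frequency is eventually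
non-decreasing).  Pure real analysis (`frequency_le_two_of_monotoneOn`,
`antitoneOn_clock_of_monotoneOn_frequency`): for a positive differentiable `H` on `(a, T)` with
UPPER pinching `(T−t)² H ≤ C₁`, a non-decreasing frequency `Λ = (T−t)H′/H` is `≤ 2` on `(a, T)`
(else `d/dt log((T−t)²H) = (Λ−2)/(T−t) ≥ δ/(T−t)` and `log((T−t)²H) → +∞`), hence the clock
`h = (T−t)² H` satisfies `h′ = (T−t)H(Λ−2) ≤ 0`.  Consequence for the crux
(`hiddenMonotonicity_of_bandExclusion`): under the crux hypotheses, `stub_bandExclusion` forces,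
on a final window, `Λ ≤ 2` AND `(T−t)² · adaptedEnstrophy u G t` NON-INCREASING and convergent
to a positive constant `h₀` (exact asymptotic self-similarity of the enstrophy scale) — a
Giga–Kohn-type monotone weighted-enstrophy quantity at a Type-I singular point, which is exactly
the kind of statement the route declares unavailable for Navier–Stokes ("NS is not a gradient
flow, so Giga–Kohn weighted ENERGY monotonicity is unavailable") and for which the triage panel
failed the sibling card `pinch-tauber-lambda-two` ("Riccati C⁺ ∧ pinching ⇒ Λ ≤ 2: hidden
monotonicity formula").  So the line's hardest stub is strictly stronger than the crux
(`adaptedFrequencyConverges_of_bandExclusion` gives stub ⇒ crux; a convergent `Λ` need not be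
monotone) and carries a hidden monotone quantity: the line `unsteadiness-squeeze` is dead at
`stub_bandExclusion`, and its semi-convex repair ("`Λ′ ≥ −θ(s)`, `θ → 0`") is the sibling line
`tauberian-omega-limit`'s `stub_slowDecrease` (⇔ crux, `Negative/SlowDecreaseOfCrux.lean`).
Sources: Giga–Kohn, CPAM 38 (1985) (weighted energy monotonicity); Agmon–Nirenberg, CPAM 16
(1963); triage files `Cruxes/AdaptedFrequencyConverges/TRIAGE-r1-{2,3}.md` (F2 / verdict on
pinch-tauber-lambda-two).
-/

noncomputable section

namespace Summit.NavierStokesRegularity.NavierStokesRegularity.Theorems.AdaptedFrequencyConverges.UnsteadinessSqueeze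

open scoped Topology
open Literature.Analysis.FluidPDE Set Filter MeasureTheory Real


/-- Derivative of the clock `h t = (T − t)² H t`. -/
theorem hasDerivAt_clock {H : ℝ → ℝ} {T t H' : ℝ} (hH : HasDerivAt H H' t) :
    HasDerivAt (fun s => (T - s) ^ 2 * H s) (-(2 * (T - t)) * H t + (T - t) ^ 2 * H') t := by
  have h1 : HasDerivAt (fun s => (T - s) ^ 2) (-(2 * (T - t))) t := by
    have h := (hasDerivAt_pow 2 (T - t)).comp t ((hasDerivAt_id t).const_sub T)
    have h' : HasDerivAt (fun s => (T - s) ^ 2) (((2 : ℕ) : ℝ) * (T - t) ^ (2 - 1) * -1) t := by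
      simpa [Function.comp_def] using h
    convert h' using 1
    push_cast
    ring
  exact h1.mul hH

/-- **A non-decreasing pinched frequency is at most `2`.** If `H > 0` is differentiable on
`(a, T)`, `(T−t)² H t ≤ C₁` there, and `t ↦ (T − t) H′(t)/H(t)` is non-decreasing on `(a, T)`,
then `(T − t) H′(t)/H(t) ≤ 2` on `(a, T)`. -/
theorem frequency_le_two_of_monotoneOn {H : ℝ → ℝ} {a T C₁ : ℝ}
    (hdiff : ∀ t ∈ Ioo a T, DifferentiableAt ℝ H t) (hpos : ∀ t ∈ Ioo a T, 0 < H t)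
    (hmono : MonotoneOn (fun t => (T - t) * deriv H t / H t) (Ioo a T))
    (hup : ∀ t ∈ Ioo a T, (T - t) ^ 2 * H t ≤ C₁) :
    ∀ t ∈ Ioo a T, (T - t) * deriv H t / H t ≤ 2 := by
  intro t₀ ht₀
  by_contra hgt
  push Not at hgt
  set δ : ℝ := (T - t₀) * deriv H t₀ / H t₀ - 2 with hδ
  have hδpos : 0 < δ := by rw [hδ]; linarith
  -- the auxiliary function `g = log((T−t)²H) + δ log(T−t)` is non-decreasing on `[t₀, T)`
  set g : ℝ → ℝ := fun t => Real.log ((T - t) ^ 2 * H t) + δ * Real.log (T - t) with hg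
  have hclockpos : ∀ t ∈ Ioo a T, 0 < (T - t) ^ 2 * H t := fun t ht => by
    have : 0 < T - t := sub_pos.2 ht.2
    exact mul_pos (by positivity) (hpos t ht)
  have hgderiv : ∀ t ∈ Ioo a T, HasDerivAt g
      (((T - t) * deriv H t / H t - 2 - δ) / (T - t)) t := by
    intro t ht
    have hTt : 0 < T - t := sub_pos.2 ht.2
    have hHt : 0 < H t := hpos t ht
    have h1 := (hasDerivAt_clock (T := T) (hdiff t ht).hasDerivAt).log (hclockpos t ht).ne'
    have h2 : HasDerivAt (fun s => δ * Real.log (T - s)) (δ * ((-1) / (T - t))) t := by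
      have h3 : HasDerivAt (fun s => T - s) (-1) t := by
        simpa using (hasDerivAt_id t).const_sub T
      exact (h3.log hTt.ne').const_mul δ
    have h12 := h1.add h2
    refine h12.congr_deriv ?_
    field_simp
    ring
  have hgderiv_nonneg : ∀ t ∈ Ico t₀ T, t ∈ Ioo a T →
      0 ≤ ((T - t) * deriv H t / H t - 2 - δ) / (T - t) := by
    intro t ht ht'
    have hTt : 0 < T - t := sub_pos.2 ht.2
    refine div_nonneg ?_ hTt.le
    have hle : (T - t₀) * deriv H t₀ / H t₀ ≤ (T - t) * deriv H t / H t := hmono ht₀ ht' ht.1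
    rw [hδ]; linarith
  have hgmono : ∀ t ∈ Ico t₀ T, g t₀ ≤ g t := by
    intro t ht
    have hsub : Icc t₀ t ⊆ Ioo a T := fun s hs => ⟨ht₀.1.trans_le hs.1, hs.2.trans_lt ht.2⟩
    have hcont : ContinuousOn g (Icc t₀ t) := fun s hs =>
      (hgderiv s (hsub hs)).continuousAt.continuousWithinAt
    have hdiffg : DifferentiableOn ℝ g (interior (Icc t₀ t)) := by
      rw [interior_Icc]
      exact fun s hs => (hgderiv s (hsub (Ioo_subset_Icc_self hs))).differentiableAt.differentiableWithinAt
    have hnonneg : ∀ s ∈ interior (Icc t₀ t), 0 ≤ deriv g s := by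
      rw [interior_Icc]
      intro s hs
      rw [(hgderiv s (hsub (Ioo_subset_Icc_self hs))).deriv]
      exact hgderiv_nonneg s ⟨hs.1.le, hs.2.trans ht.2⟩ (hsub (Ioo_subset_Icc_self hs))
    exact monotoneOn_of_deriv_nonneg (convex_Icc t₀ t) hcont hdiffg hnonneg
      (left_mem_Icc.2 ht.1) (right_mem_Icc.2 ht.1) ht.1
  -- hence `log((T−t)²H t) ≥ g t₀ − δ log(T−t)`, which is unbounded as `t ↑ T`
  have hC₁pos : 0 < C₁ := (hclockpos t₀ ht₀).trans_le (hup t₀ ht₀)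
  -- choose `t` close to `T`
  obtain ⟨ε, hεpos, hεT, hεsmall⟩ : ∃ ε : ℝ, 0 < ε ∧ ε ≤ T - t₀ ∧
      Real.log C₁ - g t₀ + 1 ≤ -(δ * Real.log ε) := by
    set A : ℝ := Real.log C₁ - g t₀ + 1 with hA
    refine ⟨min (T - t₀) (Real.exp (-(|A| / δ))), lt_min (sub_pos.2 ht₀.2) (Real.exp_pos _),
      min_le_left _ _, ?_⟩
    have hmin : 0 < min (T - t₀) (Real.exp (-(|A| / δ))) :=
      lt_min (sub_pos.2 ht₀.2) (Real.exp_pos _)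
    have hlog : Real.log (min (T - t₀) (Real.exp (-(|A| / δ)))) ≤ -(|A| / δ) := by
      calc Real.log (min (T - t₀) (Real.exp (-(|A| / δ))))
          ≤ Real.log (Real.exp (-(|A| / δ))) :=
            Real.log_le_log hmin (min_le_right _ _)
        _ = -(|A| / δ) := Real.log_exp _
    have h1 : δ * Real.log (min (T - t₀) (Real.exp (-(|A| / δ)))) ≤ δ * (-(|A| / δ)) :=
      mul_le_mul_of_nonneg_left hlog hδpos.le
    have h2 : δ * (-(|A| / δ)) = -|A| := by field_simp
    rw [h2] at h1
    linarith [le_abs_self A]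
  set t₁ : ℝ := T - ε with ht₁
  have ht₁mem : t₁ ∈ Ico t₀ T := ⟨by rw [ht₁]; linarith, by rw [ht₁]; linarith⟩
  have ht₁mem' : t₁ ∈ Ioo a T := ⟨ht₀.1.trans_le ht₁mem.1, ht₁mem.2⟩
  have hTt₁ : T - t₁ = ε := by rw [ht₁]; ring
  have hg₁ := hgmono t₁ ht₁mem
  have hlogle : Real.log ((T - t₁) ^ 2 * H t₁) ≤ Real.log C₁ :=
    Real.log_le_log (hclockpos t₁ ht₁mem') (hup t₁ ht₁mem')
  have hgt₁ : g t₁ = Real.log ((T - t₁) ^ 2 * H t₁) + δ * Real.log (T - t₁) := rfl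
  rw [← hTt₁] at hεsmall
  linarith

/-- **The clock is non-increasing.** Under the hypotheses of
`frequency_le_two_of_monotoneOn`, `h t = (T − t)² H t` is non-increasing on `(a, T)`
(`h′ = (T − t) H (Λ − 2) ≤ 0`): a Giga–Kohn-type monotone quantity. -/
theorem antitoneOn_clock_of_monotoneOn_frequency {H : ℝ → ℝ} {a T C₁ : ℝ}
    (hdiff : ∀ t ∈ Ioo a T, DifferentiableAt ℝ H t) (hpos : ∀ t ∈ Ioo a T, 0 < H t)
    (hmono : MonotoneOn (fun t => (T - t) * deriv H t / H t) (Ioo a T))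
    (hup : ∀ t ∈ Ioo a T, (T - t) ^ 2 * H t ≤ C₁) :
    AntitoneOn (fun t => (T - t) ^ 2 * H t) (Ioo a T) := by
  have hΛ := frequency_le_two_of_monotoneOn hdiff hpos hmono hup
  have hderiv : ∀ t ∈ Ioo a T, HasDerivAt (fun s => (T - s) ^ 2 * H s)
      (-(2 * (T - t)) * H t + (T - t) ^ 2 * deriv H t) t := fun t ht =>
    hasDerivAt_clock (hdiff t ht).hasDerivAt
  have hcont : ContinuousOn (fun s => (T - s) ^ 2 * H s) (Ioo a T) := fun t ht =>
    (hderiv t ht).continuousAt.continuousWithinAt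
  have hdiff' : DifferentiableOn ℝ (fun s => (T - s) ^ 2 * H s) (interior (Ioo a T)) := by
    rw [interior_Ioo]
    exact fun t ht => (hderiv t ht).differentiableAt.differentiableWithinAt
  refine antitoneOn_of_deriv_nonpos (convex_Ioo a T) hcont hdiff' ?_
  rw [interior_Ioo]
  intro t ht
  rw [(hderiv t ht).deriv]
  have hTt : 0 < T - t := sub_pos.2 ht.2
  have hHt : 0 < H t := hpos t ht
  have h1 : (T - t) * deriv H t / H t ≤ 2 := hΛ t ht
  have h2 : (T - t) * deriv H t ≤ 2 * H t := by
    rwa [div_le_iff₀ hHt] at h1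
  nlinarith [mul_le_mul_of_nonneg_left h2 hTt.le]

/-- **Band exclusion hides a monotonicity formula.** If the line's registered
`stub_bandExclusion` holds (verbatim as its hypothesis), then under the crux hypotheses there is
a final window `(t₃, T)` on which the adapted frequency is at most `2` and the weighted enstrophy
clock `(T − t)² · adaptedEnstrophy u G t` is NON-INCREASING (a Giga–Kohn-type monotone
quantity) and converges to a positive limit `h₀` as `t ↑ T`: the floor (p82804) and second-order
kernel calculus (p103653) make `Λ = (T−t)H′/H` of class `C¹` near `T`, band exclusion signs
`Λ′`, so `Λ` is non-decreasing near `T`; the upper pinching (p78510) caps `(T−t)²H`, and the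
real-analysis lemmas above conclude. -/
theorem hiddenMonotonicity_of_bandExclusion : (∀ (ν T : ℝ) (u : ℝ → EuclideanSpace ℝ (Fin 3) → EuclideanSpace ℝ (Fin 3)) (p : ℝ → EuclideanSpace ℝ (Fin 3) → ℝ) (x₀ : EuclideanSpace ℝ (Fin 3)) (t₀ : ℝ) (G : ℝ → EuclideanSpace ℝ (Fin 3) → ℝ), 0 < ν → 0 < T → IsClassicalNSSolutionOn (Ico 0 T) ν 0 u p → IsLerayHopfOn T ν 0 (u 0) u → HasRapidSpatialDecay (u 0) → IsTypeIBlowup u T → t₀ ∈ Ico 0 T → (∀ r : ℝ, 0 < r → eLpNorm (Function.uncurry u) ⊤ (volume.restrict (parabolicCylinder r (T, x₀))) = ⊤) → IsAdaptedBackwardKernel ν u (Ico t₀ T) T x₀ G → IsGaussianComparable G (Ico t₀ T) T x₀ → ∀ (t₁ c : ℝ), t₁ ∈ Ico t₀ T → 0 < c → (∀ t ∈ Ico t₁ T, c ≤ (T - t) ^ 2 * adaptedEnstrophy u G t) → ∃ t₂ ∈ Ico t₁ T, ∀ τ ∈ Ico t₂ T, 0 ≤ (T - τ) * deriv (adaptedFrequency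 u G T) τ) →
    ∀ (ν T : ℝ) (u : ℝ → EuclideanSpace ℝ (Fin 3) → EuclideanSpace ℝ (Fin 3)) (p : ℝ → EuclideanSpace ℝ (Fin 3) → ℝ) (x₀ : EuclideanSpace ℝ (Fin 3)) (t₀ : ℝ) (G : ℝ → EuclideanSpace ℝ (Fin 3) → ℝ), 0 < ν → 0 < T → IsClassicalNSSolutionOn (Ico 0 T) ν 0 u p → IsLerayHopfOn T ν 0 (u 0) u → HasRapidSpatialDecay (u 0) → IsTypeIBlowup u T → t₀ ∈ Ico 0 T → (∀ r : ℝ, 0 < r → eLpNorm (Function.uncurry u) ⊤ (volume.restrict (parabolicCylinder r (T, x₀))) = ⊤) → IsAdaptedBackwardKernel ν u (Ico t₀ T) T x₀ G → IsGaussianComparable G (Ico t₀ T) T x₀ →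
      ∃ t₃ ∈ Ico t₀ T, (∀ t ∈ Ioo t₃ T, adaptedFrequency u G T t ≤ 2) ∧
        AntitoneOn (fun t => (T - t) ^ 2 * adaptedEnstrophy u G t) (Ioo t₃ T) ∧
        ∃ h₀ : ℝ, 0 < h₀ ∧
          Tendsto (fun t => (T - t) ^ 2 * adaptedEnstrophy u G t) (𝓝[<] T) (𝓝 h₀) := by
  intro hBE ν T u p x₀ t₀ G hν hT hcl hLH hdec hTI ht₀ hsing hker hcmp
  -- floor, band exclusion, second-order kernel calculus, upper pinching
  obtain ⟨t₁, ht₁, c, hc, hfloor⟩ :=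
    Summit.NavierStokesRegularity.NavierStokesRegularity.Theorems.AdaptedFrequencyConverges.TauberianOmegaLimit.stub_pinchingLower
      ν T u p x₀ t₀ G hν hT hcl hLH hdec hTI ht₀ hsing hker hcmp
  obtain ⟨t₃, ht₃, hband⟩ :=
    hBE ν T u p x₀ t₀ G hν hT hcl hLH hdec hTI ht₀ hsing hker hcmp t₁ c ht₁ hc hfloor
  obtain ⟨a, ha, hC2⟩ := stub_enstrophyC2 ν T u p x₀ t₀ G hν hT hcl hLH hdec hTI ht₀ hsing hker hcmp
  obtain ⟨t₄, ht₄, C₁, hup⟩ :=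
    Summit.NavierStokesRegularity.NavierStokesRegularity.Theorems.AdaptedFrequencyConverges.TauberianOmegaLimit.stub_pinchingUpper
      ν T u p x₀ t₀ G hν hT hcl hLH hdec hTI ht₀ hsing hker hcmp
  -- a common final window `(t₅, T)`
  set t₅ : ℝ := max (max t₃ t₄) a with ht₅
  have ht₅T : t₅ < T := max_lt (max_lt ht₃.2 ht₄.2) ha.2
  have h35 : t₃ ≤ t₅ := (le_max_left _ _).trans (le_max_left _ _)
  have h45 : t₄ ≤ t₅ := (le_max_right _ _).trans (le_max_left _ _)
  have ha5 : a ≤ t₅ := le_max_right _ _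
  have h15 : t₁ ≤ t₅ := ht₃.1.trans h35
  refine ⟨t₅, ⟨ha.1.trans ha5, ht₅T⟩, ?_⟩
  have hsub : Ioo t₅ T ⊆ Ioo a T := fun t ht => ⟨ha5.trans_lt ht.1, ht.2⟩
  -- positivity, differentiability and upper pinching of `H` on the window
  have hpos : ∀ t ∈ Ioo t₅ T, 0 < adaptedEnstrophy u G t := by
    intro t ht
    have h1 : c ≤ (T - t) ^ 2 * adaptedEnstrophy u G t := hfloor t ⟨h15.trans ht.1.le, ht.2⟩
    have h2 : 0 < (T - t) ^ 2 := by
      have : 0 < T - t := sub_pos.2 ht.2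
      positivity
    by_contra hle
    push Not at hle
    have : (T - t) ^ 2 * adaptedEnstrophy u G t ≤ 0 := mul_nonpos_of_nonneg_of_nonpos h2.le hle
    linarith
  have hC2' : ContDiffOn ℝ 2 (adaptedEnstrophy u G) (Ioo t₅ T) := hC2.mono hsub
  have hdiff : ∀ t ∈ Ioo t₅ T, DifferentiableAt ℝ (adaptedEnstrophy u G) t := fun t ht =>
    (hC2'.differentiableOn (by norm_num) t ht).differentiableAt (isOpen_Ioo.mem_nhds ht)
  have hup' : ∀ t ∈ Ioo t₅ T, (T - t) ^ 2 * adaptedEnstrophy u G t ≤ C₁ := fun t ht =>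
    hup t ⟨h45.trans ht.1.le, ht.2⟩
  -- `Λ = (T−t)H′/H` is `C¹` on the window (from `H ∈ C²`, `H > 0`)
  have hΛC1 : ContDiffOn ℝ 1
      (fun s => (T - s) * deriv (adaptedEnstrophy u G) s / adaptedEnstrophy u G s) (Ioo t₅ T) := by
    have hH1 : ContDiffOn ℝ 1 (deriv (adaptedEnstrophy u G)) (Ioo t₅ T) := by
      have h2 : ContDiffOn ℝ (1 + 1) (adaptedEnstrophy u G) (Ioo t₅ T) := by
        simpa [show ((1 : WithTop ℕ∞) + 1) = 2 by norm_num] using hC2'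
      exact ((contDiffOn_succ_iff_deriv_of_isOpen isOpen_Ioo).1 h2).2.2
    refine ContDiffOn.div ?_ (hC2'.of_le (by norm_num)) (fun s hs => (hpos s hs).ne')
    exact (contDiffOn_const.sub contDiffOn_id).mul hH1
  have hfun : adaptedFrequency u G T =
      fun s => (T - s) * deriv (adaptedEnstrophy u G) s / adaptedEnstrophy u G s := by
    funext s; rfl
  -- `Λ′ ≥ 0` on the window (band exclusion), hence `Λ` non-decreasing there
  have hmono' : MonotoneOn
      (fun s => (T - s) * deriv (adaptedEnstrophy u G) s / adaptedEnstrophy u G s) (Ioo t₅ T) := by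
    refine monotoneOn_of_deriv_nonneg (convex_Ioo t₅ T) hΛC1.continuousOn ?_ ?_
    · rw [interior_Ioo]; exact hΛC1.differentiableOn one_ne_zero
    · rw [interior_Ioo]
      intro τ hτ
      have h1 : 0 ≤ (T - τ) * deriv (adaptedFrequency u G T) τ := hband τ ⟨h35.trans hτ.1.le, hτ.2⟩
      have h2 := (mul_nonneg_iff_of_pos_left (sub_pos.2 hτ.2)).1 h1
      rwa [hfun] at h2
  have hmono : MonotoneOn (adaptedFrequency u G T) (Ioo t₅ T) := by rw [hfun]; exact hmono'
  have hanti : AntitoneOn (fun t => (T - t) ^ 2 * adaptedEnstrophy u G t) (Ioo t₅ T) :=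
    antitoneOn_clock_of_monotoneOn_frequency hdiff hpos hmono' hup'
  refine ⟨fun t ht => ?_, hanti, ?_⟩
  · have := frequency_le_two_of_monotoneOn hdiff hpos hmono' hup' t ht
    rwa [hfun]
  -- the clock is non-increasing and bounded below by the floor `c > 0`, hence converges to `h₀ ≥ c`
  have hbdd : BddBelow ((fun t => (T - t) ^ 2 * adaptedEnstrophy u G t) '' Ioo t₅ T) := by
    refine ⟨c, ?_⟩
    rintro _ ⟨t, ht, rfl⟩
    exact hfloor t ⟨h15.trans ht.1.le, ht.2⟩
  have hne : (Ioo t₅ T).Nonempty := nonempty_Ioo.2 ht₅T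
  refine ⟨sInf ((fun t => (T - t) ^ 2 * adaptedEnstrophy u G t) '' Ioo t₅ T), ?_,
    hanti.tendsto_nhdsWithin_Ioo_left hne hbdd⟩
  refine lt_of_lt_of_le hc (le_csInf (hne.image _) ?_)
  rintro _ ⟨t, ht, rfl⟩
  exact hfloor t ⟨h15.trans ht.1.le, ht.2⟩

end Summit.NavierStokesRegularity.NavierStokesRegularity.Theorems.AdaptedFrequencyConverges.UnsteadinessSqueeze

end
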